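import Summits.AtomisticToContinuum.Crystallization.Theses.DisclinationRation
import Summits.AtomisticToContinuum.Crystallization.Theorems.FiveFoldRation.Negative.WithoutGood
import Summits.AtomisticToContinuum.Crystallization.Theorems.FiveFoldRation.Negative.StubShellMutualFalse
import Summits.AtomisticToContinuum.Crystallization.Theorems.FiveFoldRation.Negative.CoreConclusionCubic
import Summits.AtomisticToContinuum.Crystallization.Theorems.FiveFoldRation.Negative.CoreAnatomy

/-!
# Disproof of `FiveFoldRation` — findings (cdisprove seat; cycle 1 and CYCLE 2, 2026-08-17)

CYCLE 2 (seat g2) IN ONE PARAGRAPH — NO KILL, none expected; new and kernel-checked unless marked: (c′) LANDED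
p172213 `Theorems/FiveFoldRation/Negative/CoreConclusionCubic.lean` — `densityZero_of_layerInequality` (the back end
of line `Sketch` is unconditional: `hsep` + `LayerInequality S` ⇒ the crux's conclusion for `S`),
`not_layerInequality_cubic`, `not_linearAxisCensusAt_cubic`, `cubic_axisSites_eq` (`ℤ³`: the conclusion predicate
of the open stub and its linear strengthening are CONTENTFUL, not closable by arithmetic on `C₁, W₀`); (d′) LANDED
p172900 `Theorems/FiveFoldRation/Negative/CoreAnatomy.lean` — anatomy of the one open stub `stub_dr5_core`:
`core_iff_dropFrontEnd`, `isAlphabetGood_of_hasColumns`, `core_iff_dropGood`, `core_false_without_good` — the stub ⇔ `IsAdmissible δ S → LayerInequality S`, `hgood` and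
`FrontEnd` imply each other's role, both deleted ⇒ false; no smuggled gap in `FiveFoldRation_of`; (a″) `hsep` IS
LOAD-BEARING — near-miss `fiveFoldRation_false_without_sep` with the scale-drifted rod `F_ε(Rod)`, `ε = 1/100`
(pattern-level numerics `drift/driftcheck.py`, in-session + kit j027796: all sites good, worst deviation `0.0324`
near / `0.0222` far, axis sites `±n^{0.99}` not {fcc,hcp}-good, `axisCount ≈ 2L·Z₀^{1/99}` about far axis centres);
hence every census constant must carry `δ`, and `hdense` is decoration on paper; (b′) closed / knotted columns;
(e′) the engine with page-level cites — Li–Naber 2020 Cor. 1.4 / Thm 1.5 (no noncollapsing needed), LMPS 2015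
Thm 1, Petrunin 2009, and why arXiv:2111.02301 (integral polyhedral 3-manifolds) does NOT transfer.  Cycle-1 text
follows unchanged; cycle-2 sections are at the end of the file.

CYCLE 1:

Crux (stmt-AtomisticToContinuum-15799, route DisclinationRation, rank 3, K2 "flat space rations five-fold
axes"): `∀ δ > 0, ∀ S ⊆ ℝ³` `δ`-separated, relatively dense, EVERY site `1/20`-good in the alphabet
{fcc, hcp, decahedral axis} (first shell `{z ∈ S : z ≠ y, |z − y| < 13/10·d_y}` rescaled by the
nearest-neighbour distance `d_y`, matched after a linear isometry `A ∈ O(3)` and a bijection) `⇒` the sites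
that are not `1/20`-{fcc,hcp}-good have density zero uniformly on balls (`∀ θ > 0 ∃ L₀ ∀ L ≥ L₀ ∀ c,
#(axis sites in B̄_L(c)) ≤ θ L³`, `L₀` may depend on `S`).

VERDICT OF THIS CYCLE: NO KILL — and none expected inside the statement as typed (§ (e)).  What is
certified / recorded here:

(a) LOAD-BEARING ANALYSIS.
  * Statement read back symbol by symbol (§ (a) below): no junk — `d_y = sInf` of a set bounded below by
    `δ > 0` and attained; `T_y` finite; `Set.ncard` of a bounded subset of a separated set; `A` ranges over
    `O(3)` (all three patterns are centrosymmetric-or-mirror-symmetric, so reflections add nothing); the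
    decahedral pattern is twelve DISTINCT unit vectors (poles `±e₃`, two ALIGNED pentagonal rings at height
    `±1/2`, radius `√3/2`; in-ring chord `√3·sin 36° = 1.01807`); `L₀` after `S` (no uniformity in `S` is
    asked; even the uniform version is believed true, § (e)).  Negative `L` is the prover's to avoid (`∃ L₀`).
  * `fiveFoldRation_hypotheses_satisfiable` (THEOREM, sorry-free; its witness LANDED as
    `Theorems/FiveFoldRation/Negative/StubShellMutualFalse.lean`, p167277 ACCEPTED, imported): the three
    hypotheses are met by
    the fcc lattice `fccSet = D₃/√2` — `1`-separated, covering radius `≤ 3`, every site `1/20`-fcc-good IN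
    THE CRUX'S OWN INLINE SENSE (`sInf_dist_fcc : d_y = 1`, `fcc_shell_iff : T_y = y + fccKissingPattern`,
    matching `A = id`, `e : t ↦ t − y`, error `0`).  On it the conclusion is trivially true (nothing is
    counted), so it is a non-vacuity witness; it is also the object every negative lemma below needs.
  * `hgood` (every site alphabet-good) is load-bearing: `fiveFoldRation_false_without_good` (THEOREM,
    LANDED p167921 as `Theorems/FiveFoldRation/Negative/WithoutGood.lean`, imported here) — `ℤ³`
    (six-point shells, no site {fcc,hcp}-good, `> L³/64` sites in `B̄_L(0)`) kills the crux with `hgood`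
    deleted.  `hsep` / `hdense`: no witness either way — any counterexample to the
    crux without them would still need a positive density of axis sites in an everywhere-good set, which
    § (e) says does not exist; `hdense` is PROBABLY DECORATION given `hgood` (every closed half-space
    through a good site contains a shell point within `1.07 d_y` — covering radius `45°–46°` of the three
    patterns + `3°` — so `S` continues in every direction; only an unbounded drift of the local scale `d_y`
    could spoil a uniform covering radius, and scale comparability `d_z/d_y ∈ [20/21, 21/20]` along bonds +
    FJM-type rigidity make that implausible).  Information for the prover, not a lemma.
(b) TIGHTNESS / NATURAL STRENGTHENINGS.
  * `not_axisExclusion` (near-miss, `sorry` = infinite witness): the conclusion cannot be upgraded from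
    "density zero" to "no axis site" — the closed DECAHEDRAL ROD is admissible with a whole line of axis
    sites.  Numerics at the PATTERN level of this crux (kit j026730, `rod/rodcheck.py`: five fcc wedges of
    dihedral `arccos(1/3)` about a `[110]` axis, azimuthal squeeze `c = 2π/(5 arccos(1/3)) = 1.020854`,
    balanced radial factor `c^{-1/2}`; for every interior site: `|T_y| = 12`, min over {fcc,hcp,deca} of the
    O(3)×bijection MINIMAX deviation, shell/gap ratios).  RESULT (kit j026730 DONE, numpy/scipy,
    153 interior sites `r ≤ 3.6`, `|z| ≤ 1.05`; the pure-python twin `rod/rodcheck_pure.py` run in-session on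
    one axial period, 91 sites, gives identical figures — both outputs attached as evidence): all sites have
    `|T_y| = 12`; ALL are alphabet-good with
    WORST minimax deviation `0.0201` (ring sites, hcp-like) — a factor `2.5` inside `1/20`; the axis sites
    are decahedral-good at deviation `0.0078` and NOT {fcc,hcp}-good (pole valence `5` at rescaled in-shell
    distance `≤ 1.0154 < √2 − 1/10`; best fcc/hcp fits `≥ 0.38`); `90/91` sites are {fcc,hcp}-good (hcp-like
    exactly on the five twin planes `r = 0.87, 1.71, 2.57, 3.43`, fcc-like inside the wedges); shell radii
    `≤ 1.0165·d_y` (the repaired stub 2 claims `≤ 21/20`), next site `≥ 1.4047·d_y` (cutoff `13/10`).  So the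
    rod IS an admissible `S` of this crux with a full line of axis sites: `AxisExclusion` is false with
    margin `0.03`, and the crux's hypotheses do not secretly exclude axis sites (K1's alphabet is consistent).
    Obstruction to a Lean proof: the witness is necessarily infinite (no finite set is everywhere-good: an
    extreme point would need a shell point beyond it), and at the pattern level even its finite shadows
    need inequalities in `ℚ(√2,√3,√5)` or interval arithmetic for `cos` — days, for a fact nobody disputes.
  * REAL-COORDINATE RIGIDITY IS FALSE AT LARGE SCALE (paper, important for the line): "twin fans are flat
    half-planes" and "axes are straight lines" hold EXACTLY in the ideal unit-edge tetrahedron/octahedron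
    complex but NOT in `ℝ³`: the map `x ↦ R(ε log|x|)·x` (rotation by angle `ε log|x|` about the axis) has
    strain `O(ε)` everywhere and bends every fan into a logarithmic spiral (turning `(1/20)·log(r₂/r₁)`
    between radii `r₁ < r₂` is compatible with all shells `1/20`-good); a kink of angle `α ≲ 1/20` in an
    axis, smoothed over any length, costs strain `O(α)` globally.  So any stub asserting metric flatness /
    straightness / parallelism of axes in real coordinates with constants is refutable in principle (by
    infinite witnesses); state such things in the IDEAL polyhedral metric, where they are exact.  (Same
    advice as the sibling disproof `Cruxes/FiveFoldRationingR/Disproof.lean`, ADVICE 2.)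
  * The route's own CHEAPEST FALSIFIER ("doubly periodic array of PARALLEL five-fold columns joined by twin
    planes") cannot exist even before strain is priced: in the cross-section the twin traces form a planar
    straight-line graph, 5-valent with `72°` corners at every axis; a bounded face would be a convex polygon
    with all corners `≈ 70.5°–72°`, impossible (`n·(180° − 72°) = 360°` has no integer solution), an unbounded
    convex face has total turning `≤ 180°` hence at most ONE corner, so no twin trace joins two axes and a
    second axis `B` inside a `72°`-wedge of `A` would have to fit its five `72°`-spaced rays inside that
    wedge — absurd.  Hence AT MOST ONE AXIS per parallel family with flat fans; with the (true, intrinsic)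
    Cohn-Vossen count, `≤ ⌊2π/ω₅⌋ = 48` parallel axes in any complete flat cone cross-section regardless of
    fan shape (`ω₅ = 2π − 5 arccos(1/3) = 0.128340 rad`).  Neither is a proof of the crux (they assume the
    parallel-column structure), but they close the door the route file left open.
(c) SMALL-MODEL REFUTATIONS OF STRENGTHENED PROOF STEPS: none needed this cycle — the tempting local
    shortcuts are TRUE here because the alphabet is pattern-level: within a good shell, pattern distances
    `{1, 1.018}` versus `≥ √2` separate as rescaled actual distances `≤ 1.118` versus `≥ 1.314`, so the
    link of every site is combinatorially EXACTLY a cuboctahedron, an anticuboctahedron or the bicapped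
    pentagonal prism, poles are the only `5`-valent link vertices (pole lemma TRUE), and the sibling crux's
    worry (non-T/O torn-free shells at `2.5–3 %`) does not arise at pattern level.  The one place where
    `1/20` is generous is scale comparability across a bond (`d_z ≥ 20/21·d_y` needs the `46°` covering
    argument, not just the triangle inequality) — the content of the repaired stub 2.
(d) TARGETS — line `Sketch` (lead prover-line-stmt-AtomisticToContinuum-15799-0; `stuck_stubs = []`):
  * `stub_dr5_shellMutual_false` (THEOREM, LANDED p167277 ACCEPTED, commit 55355d2fb37e; § (d)): the registered FRONT-END
    stub 2 is FALSE AS TYPED — variable capture: its `d_z` is written `sInf ((fun z => dist z z) '' (S ∖ {z}))`,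
    the binder shadows `z`, the function is the constant `0`, so the conclusion's conjunct
    `dist y z < 13/10·d_z` reads `dist y z < 0`.  Witness: `fccSet`, `y = 0`, `z = (1,1,0)/√2`.  The same
    captured text is the FIRST HYPOTHESIS of `stub_dr5_poleLemma` and `stub_dr5_core` (vacuous as typed —
    do not accept ex-falso landings).  Classification: stub-MISSTATED; repair = `fun w => dist w z` in all
    12 occurrences (Sketch.lean lines 63, 67, 75, 86, 90, 98); the repaired statement (IdeatorOne's
    `ShellMutual` + `d ≤ dist ≤ 21/20·d` both ways) is believed TRUE (all twelve typed points of all three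
    patterns have norm exactly `1`, so `21/20` is the right constant; symmetry by the `46°` covering radius).
  * `stub_dr5_layerBootstrap` (pure real analysis) is TRUE — checked on paper, no target: at `W = r/16` the
    layer inequality reads `g(s) ≥ 3·g(5s/6) − (256/3)·C₁ s²` for `g = f`, `s = 3r/4 ≥ 12 W₀`; if
    `g(5s/6) > K·C₁ s²` (`K ≈ 160`) at ONE `s ≥ 12 W₀` then `g` grows like `2.08ⁿ` along `s·(6/5)ⁿ`, against
    the cubic bound `8 C₀ s (6/5)ⁿ` — contradiction; so `f(t) ≤ K C₁ t²` for all `t ≥ 10 W₀` and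
    `ρ₀ = max (10 W₀) (K C₁/θ)` works (uniform in `f`, as required; `W₀ ≤ 0` is harmless — use `W = r/16 > 0`).
    Note the stub only ever yields a QUADRATIC census, which is all the bridge needs.
  * `stub_dr5_core` (`StripForestInequality`): no independent lever — it is implied by a linear census with
    an `S`-dependent constant (take the bracket term `= 0`, `C₁ = M/8`, `W₀ = 1/16`) and implies a quadratic
    one; it stands or falls with the crux's own mechanism (§ (e)).
  * `stub_dr5_poleLemma` (after repair of its hypothesis) and `stub_dr5_chains`: TRUE (pole valence `5`
    versus `4`-regular (anti)cuboctahedra at pattern distance `< √2`, margin `(√2 − 1.118)`; re-orientation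
    `diag(1,−1,−1)` preserves the typed decahedral set, `k ↦ −k mod 5`).  No target.
(e) WHY IT RESISTS (for the provers).  At pattern level `1/20` the bond graph is symmetric and locally
    rigid, every vertex link is one of the three typed polyhedra, square link faces are capped (octahedron
    completion from the neighbour's full link), so the IDEAL unit-edge T/O complex `K(S)` exists; its edge
    words are `toto` (fcc-type), `ttoo` (hcp-in-plane type, also the ring–centre bonds of the prism) and
    `t⁵` (axis bonds) with dihedral sums `360°, 360°, 352.64°`: a flat cone-3-manifold, CBB(0), singular
    set = the axis chains (deficit `ω₅` each), complete and `(1 ± O(1/20))`-bi-Lipschitz to `ℝ³`.  Then the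
    crux holds with room: Petrunin's curvature-integral bound (`∫_{B_r} Sc ≤ c(3)·r` for CBB(0), polyhedral
    version) gives singular LENGTH `O(r/ω₅)` in every `r`-ball, i.e. `O(L)` axis sites in `B̄_L(c)`, UNIFORMLY
    in `S` and `c`; for parallel axes 2-D Cohn-Vossen gives `≤ 48` axes in total and the chamber count above
    gives `≤ 1`.  A kill would need an everywhere-good `S` whose ideal complex is NOT this cone-manifold —
    impossible at pattern level — or closed / knotted / skew axis families at positive density, which the
    same curvature bound forbids (skew singular lines are still CBB(0); closed unknotted loops have trivial
    longitude holonomy, contradicting the screw holonomy `length(C) > 0` along the loop).  The refuter has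
    no lever left on the statement; the risk of this crux is FORMALISATION SIZE (cellulation + comparison
    geometry absent from Mathlib), not truth.

Every `def … : Prop` below (and in the two imported Negative files) is a hypothesis-analysis predicate of
THIS crux or a verbatim stub statement; §§ (a)(d) are IMPORTED from the landed Negative files (p167277,
p167921) and only indexed here.
-/

noncomputable section

namespace Summit.AtomisticToContinuum.Crystallization.Cruxes.FiveFoldRation.Disproof


open Literature.Geometry.DiscreteGeometry

open Summit.AtomisticToContinuum.Crystallization.Theorems.FiveFoldRation

/-! ## (a) The fcc witness — LANDED as `Theorems/FiveFoldRation/Negative/StubShellMutualFalse.lean` (p167277); imported, indexed here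

`Negative.fccSet` (`D₃/√2`), `Negative.fcc_separated` (`δ = 1`), `Negative.fcc_relDense` (`R₁ = 3`),
`Negative.sInf_dist_fcc` (`d_y = 1`), `Negative.fcc_shell_iff` / `Negative.fccShellEquiv` (shell = translate
of `fccKissingPattern`), `Negative.fcc_good` (the crux's inline `GA`, verbatim, at every site). -/

/-! ## (a) Hypotheses of the crux are satisfiable (non-vacuity witness = `fccSet`) -/

/-- **The three hypotheses of `FiveFoldRation` are jointly satisfiable** (`δ = 1`, `S = fccSet`):
separation, relative density and everywhere-alphabet-goodness, the latter verbatim the crux's inline `GA`.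
[folklore] -/
theorem fiveFoldRation_hypotheses_satisfiable :
    ∃ δ : ℝ, 0 < δ ∧ ∃ S : Set (EuclideanSpace ℝ (Fin 3)),
      (∀ y ∈ S, ∀ z ∈ S, y ≠ z → δ ≤ dist y z) ∧
      (∃ R₁ : ℝ, ∀ p : EuclideanSpace ℝ (Fin 3), ∃ y ∈ S, dist y p ≤ R₁) ∧ (0 : EuclideanSpace ℝ (Fin 3)) ∈ S ∧
      ∀ y ∈ S, (let d : ℝ := sInf ((fun z => dist z y) '' (S \ {y})); let T : Set (EuclideanSpace ℝ (Fin 3)) := {z : EuclideanSpace ℝ (Fin 3) | z ∈ S ∧ z ≠ y ∧ dist z y < 13 / 10 * d}; ∃ A : EuclideanSpace ℝ (Fin 3) →ₗᵢ[ℝ] EuclideanSpace ℝ (Fin 3), (∃ e : ↥T ≃ ↥Literature.Geometry.DiscreteGeometry.fccKissingPattern, ∀ t : ↥T, dist (d⁻¹ • ((t : EuclideanSpace ℝ (Fin 3)) - y)) (A ((e t : ↥Literature.Geometry.DiscreteGeometry.fccKissingPattern) : EuclideanSpace ℝ (Fin 3))) ≤ 1 / 20) ∨ (∃ e : ↥T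 ≃ ↥Literature.Geometry.DiscreteGeometry.hcpKissingPattern, ∀ t : ↥T, dist (d⁻¹ • ((t : EuclideanSpace ℝ (Fin 3)) - y)) (A ((e t : ↥Literature.Geometry.DiscreteGeometry.hcpKissingPattern) : EuclideanSpace ℝ (Fin 3))) ≤ 1 / 20) ∨ (∃ e : ↥T ≃ ↥{p : EuclideanSpace ℝ (Fin 3) | p = !₂[(0 : ℝ), 0, 1] ∨ p = !₂[(0 : ℝ), 0, -1] ∨ ∃ k : Fin 5, ∃ σ : ℝ, (σ = 1 / 2 ∨ σ = -(1 / 2)) ∧ p = !₂[Real.sqrt 3 / 2 * Real.cos (2 * Real.pi * (k : ℝ) / 5), Real.sqrt 3 / 2 * Real.sin (2 * Real.pi * (k : ℝ) / 5), σ]}, ∀ t : ↥T, dist (d⁻¹ • ((t : EuclideanSpace ℝ (Fin 3)) - y)) (A ((e t : ↥{p : EuclideanSpace ℝ (Fin 3) | p = !₂[(0 : ℝ), 0, 1] ∨ p = !₂[(0 : ℝ), 0, -1] ∨ ∃ k : Fin 5, ∃ σ : ℝ, (σ = 1 / 2 ∨ σ = -(1 / 2)) ∧ p = !₂[Real.sqrt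 3 / 2 * Real.cos (2 * Real.pi * (k : ℝ) / 5), Real.sqrt 3 / 2 * Real.sin (2 * Real.pi * (k : ℝ) / 5), σ]}) : EuclideanSpace ℝ (Fin 3))) ≤ 1 / 20)) :=
  ⟨1, one_pos, Negative.fccSet, Negative.fcc_separated, ⟨3, Negative.fcc_relDense⟩,
    ⟨0, by simp, by rw [show intVec (0 : Fin 3 → ℤ) = 0 from by ext i; simp [intVec]]; simp⟩, Negative.fcc_good⟩

/-! ## (d) Targets — line `Sketch`: the registered stub `stub_dr5_shellMutual` is FALSE as typed (LANDED p167277) -/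

/-- Stub 2 of the registered skeleton, verbatim (`Negative.StubShellMutualSig` = `Sketch.Sig.stub_dr5_shellMutual`
textually), is false: variable capture `fun z => dist z z` (`Negative.sInf_capture`), fcc witness. -/
example : ¬ Negative.StubShellMutualSig := Negative.stub_dr5_shellMutual_false

/-- The captured scale is identically zero. -/
example (S : Set (EuclideanSpace ℝ (Fin 3))) (z : EuclideanSpace ℝ (Fin 3)) :
    sInf ((fun z => dist z z) '' (S \ {z})) = 0 := Negative.sInf_capture S z

/-! ## (a′) `hgood` is load-bearing (LANDED p167921; witness `ℤ³`) -/

/-- `FiveFoldRation` with the hypothesis "every site is alphabet-good" DELETED (everything else verbatim).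
A weakened crux for hypothesis analysis (Negative/ lane), not a literature fact. -/
def FiveFoldRationWithoutGood : Prop :=
  let GF : Set (EuclideanSpace ℝ (Fin 3)) → EuclideanSpace ℝ (Fin 3) → Prop := fun S y => let d : ℝ := sInf ((fun z => dist z y) '' (S \ {y})); let T : Set (EuclideanSpace ℝ (Fin 3)) := {z : EuclideanSpace ℝ (Fin 3) | z ∈ S ∧ z ≠ y ∧ dist z y < 13 / 10 * d}; ∃ A : EuclideanSpace ℝ (Fin 3) →ₗᵢ[ℝ] EuclideanSpace ℝ (Fin 3), (∃ e : ↥T ≃ ↥Literature.Geometry.DiscreteGeometry.fccKissingPattern, ∀ t : ↥T, dist (d⁻¹ • ((t : EuclideanSpace ℝ (Fin 3)) - y)) (A ((e t : ↥Literature.Geometry.DiscreteGeometry.fccKissingPattern) : EuclideanSpace ℝ (Fin 3))) ≤ 1 / 20) ∨ (∃ e : ↥T ≃ ↥Literature.Geometry.DiscreteGeometry.hcpKissingPattern, ∀ t : ↥T, dist (d⁻¹ • ((t : EuclideanSpace ℝ (Fin 3)) - y)) (A ((e t : ↥Literature.Geometry.DiscreteGeometry.hcpKissingPattern) : EuclideanSpace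 ℝ (Fin 3))) ≤ 1 / 20); ∀ δ : ℝ, 0 < δ → ∀ S : Set (EuclideanSpace ℝ (Fin 3)), (∀ y ∈ S, ∀ z ∈ S, y ≠ z → δ ≤ dist y z) → (∃ R₁ : ℝ, ∀ p : EuclideanSpace ℝ (Fin 3), ∃ y ∈ S, dist y p ≤ R₁) → (∀ θ : ℝ, 0 < θ → ∃ L₀ : ℝ, ∀ L : ℝ, L₀ ≤ L → ∀ c : EuclideanSpace ℝ (Fin 3), (({y : EuclideanSpace ℝ (Fin 3) | y ∈ S ∧ dist y c ≤ L ∧ ¬ GF S y} : Set (EuclideanSpace ℝ (Fin 3))).ncard : ℝ) ≤ θ * L ^ 3)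

/-- **`hgood` is load-bearing** (LANDED, p167921, `Theorems/FiveFoldRation/Negative/WithoutGood.lean`,
def-free there; restated here against the named predicate): without `hgood` the statement fails on
`ℤ³ = Set.range intVec` (`1`-separated, covering radius `≤ 2`; every first shell has `≤ 6` points, so no
site is {fcc,hcp}-good and the counted set is all of `ℤ³ ∩ B̄_L(0)`, of cardinality `> L³/64` for `L ≥ 8`,
against `θ = 1/64`). [folklore] -/
theorem fiveFoldRation_false_without_good : ¬ FiveFoldRationWithoutGood :=
  Summit.AtomisticToContinuum.Crystallization.Theorems.FiveFoldRation.Negative.fiveFoldRation_false_without_good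

/-! ## (b) Tightness: "density zero" cannot become "no axis site" (near-miss, infinite witness) -/

/-- `FiveFoldRation` with its conclusion STRENGTHENED from "axis sites have density zero" to "there is no
axis site" (every site is {fcc,hcp}-good): AXIS EXCLUSION.  Hypotheses verbatim. A strengthened crux for
tightness analysis (Negative/ lane), not a literature fact. -/
def AxisExclusion : Prop :=
  let GA : Set (EuclideanSpace ℝ (Fin 3)) → EuclideanSpace ℝ (Fin 3) → Prop := fun S y => let d : ℝ := sInf ((fun z => dist z y) '' (S \ {y})); let T : Set (EuclideanSpace ℝ (Fin 3)) := {z : EuclideanSpace ℝ (Fin 3) | z ∈ S ∧ z ≠ y ∧ dist z y < 13 / 10 * d}; ∃ A : EuclideanSpace ℝ (Fin 3) →ₗᵢ[ℝ] EuclideanSpace ℝ (Fin 3), (∃ e : ↥T ≃ ↥Literature.Geometry.DiscreteGeometry.fccKissingPattern, ∀ t : ↥T, dist (d⁻¹ • ((t : EuclideanSpace ℝ (Fin 3)) - y)) (A ((e t : ↥Literature.Geometry.DiscreteGeometry.fccKissingPattern) : EuclideanSpace ℝ (Fin 3))) ≤ 1 / 20) ∨ (∃ e : ↥T ≃ ↥Literature.Geometry.DiscreteGeometry.hcpKissingPattern,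 ∀ t : ↥T, dist (d⁻¹ • ((t : EuclideanSpace ℝ (Fin 3)) - y)) (A ((e t : ↥Literature.Geometry.DiscreteGeometry.hcpKissingPattern) : EuclideanSpace ℝ (Fin 3))) ≤ 1 / 20) ∨ (∃ e : ↥T ≃ ↥{p : EuclideanSpace ℝ (Fin 3) | p = !₂[(0 : ℝ), 0, 1] ∨ p = !₂[(0 : ℝ), 0, -1] ∨ ∃ k : Fin 5, ∃ σ : ℝ, (σ = 1 / 2 ∨ σ = -(1 / 2)) ∧ p = !₂[Real.sqrt 3 / 2 * Real.cos (2 * Real.pi * (k : ℝ) / 5), Real.sqrt 3 / 2 * Real.sin (2 * Real.pi * (k : ℝ) / 5), σ]}, ∀ t : ↥T, dist (d⁻¹ • ((t : EuclideanSpace ℝ (Fin 3)) - y)) (A ((e t : ↥{p : EuclideanSpace ℝ (Fin 3) | p = !₂[(0 : ℝ), 0, 1] ∨ p = !₂[(0 : ℝ), 0, -1] ∨ ∃ k : Fin 5, ∃ σ : ℝ, (σ = 1 / 2 ∨ σ = -(1 / 2)) ∧ p = !₂[Real.sqrt 3 / 2 * Real.cos (2 * Real.pi * (k : ℝ) / 5),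 Real.sqrt 3 / 2 * Real.sin (2 * Real.pi * (k : ℝ) / 5), σ]}) : EuclideanSpace ℝ (Fin 3))) ≤ 1 / 20); let GF : Set (EuclideanSpace ℝ (Fin 3)) → EuclideanSpace ℝ (Fin 3) → Prop := fun S y => let d : ℝ := sInf ((fun z => dist z y) '' (S \ {y})); let T : Set (EuclideanSpace ℝ (Fin 3)) := {z : EuclideanSpace ℝ (Fin 3) | z ∈ S ∧ z ≠ y ∧ dist z y < 13 / 10 * d}; ∃ A : EuclideanSpace ℝ (Fin 3) →ₗᵢ[ℝ] EuclideanSpace ℝ (Fin 3), (∃ e : ↥T ≃ ↥Literature.Geometry.DiscreteGeometry.fccKissingPattern, ∀ t : ↥T, dist (d⁻¹ • ((t : EuclideanSpace ℝ (Fin 3)) - y)) (A ((e t : ↥Literature.Geometry.DiscreteGeometry.fccKissingPattern) : EuclideanSpace ℝ (Fin 3))) ≤ 1 / 20) ∨ (∃ e : ↥T ≃ ↥Literature.Geometry.DiscreteGeometry.hcpKissingPattern, ∀ t : ↥T, dist (d⁻¹ • ((t : EuclideanSpace ℝ (Fin 3)) - y)) (A ((e t : ↥Literature.Geometry.DiscreteGeometry.hcpKissingPattern)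 : EuclideanSpace ℝ (Fin 3))) ≤ 1 / 20); ∀ δ : ℝ, 0 < δ → ∀ S : Set (EuclideanSpace ℝ (Fin 3)), (∀ y ∈ S, ∀ z ∈ S, y ≠ z → δ ≤ dist y z) → (∃ R₁ : ℝ, ∀ p : EuclideanSpace ℝ (Fin 3), ∃ y ∈ S, dist y p ≤ R₁) → (∀ y ∈ S, GA S y) → (∀ y ∈ S, GF S y)

/-- NEAR-MISS (true, not formalised): **axis exclusion is false** — the closed decahedral rod (five fcc
wedges about a `[110]` axis, azimuthal squeeze `1.020854`, balanced radial factor) is `δ`-separated,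
relatively dense and everywhere alphabet-good at `1/20`, and its axis column consists of sites that are NOT
`1/20`-{fcc,hcp}-good (pole valence `5`).  Pattern-level numerics: kit j026730 (`rod/rodcheck.py`), figures
in the module docstring § (b).  Obstruction to a Lean proof: infinite witness with transcendental
coordinates (squeezed azimuths); even a finite two-shell shadow needs `ℚ(√2,√3,√5)` / `cos`-interval
inequalities by the hundred.  Numerics: worst deviation `0.0201 < 1/20`, axis pole valence `5`. -/
theorem not_axisExclusion : ¬ AxisExclusion := by
  sorry

/-! # CYCLE 2 (seat refuter-cdisprove-…-15799-g2, 2026-08-17)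

## (c′) The conclusion predicates of the open core are CONTENTFUL — LANDED p172213
(`Theorems/FiveFoldRation/Negative/CoreConclusionCubic.lean`, imported, indexed here)

`LayerInequality S` (conclusion of `stub_dr5_core`) and its linear strengthening `LinearAxisCensusAt S` both FAIL
on `ℤ³` — a `1`-separated, relatively dense set in which no site is good — so neither is a soft / arithmetical
predicate that a prover could discharge by a clever choice of `C₁, W₀` (the tempting `W₀ ≤ 0` or "bracket absorbs
everything" escapes do not exist: with `W = r/16` and cubic axis growth `V r³` the inequality forces
`V·(1 − (0.75³ − 0.5³)/3)·r³ = 0.901 V r³ ≤ 16 C₁ r²`).  The same file makes the whole BACK END of line `Sketch`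
unconditional: `densityZero_of_layerInequality : 0 < δ → hsep → LayerInequality S → (∀ θ > 0, ∃ L₀, …)`. -/

/-- Back end of line `Sketch`, unconditional (landed p172213): separation + layer inequality ⇒ density zero for
that `S`, via the landed `stub_dr5_cubic` and `stub_dr5_layerBootstrap`. -/
example {δ : ℝ} (hδ : 0 < δ) {S : Set E3} (hsep : ∀ y ∈ S, ∀ z ∈ S, y ≠ z → δ ≤ dist y z)
    (hL : LayerInequality S) :
    ∀ θ : ℝ, 0 < θ → ∃ L₀ : ℝ, ∀ L : ℝ, L₀ ≤ L → ∀ c : E3, axisCount S c L ≤ θ * L ^ 3 :=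
  Negative.densityZero_of_layerInequality hδ hsep hL

/-- `LayerInequality` fails on `ℤ³` (landed p172213): any proof of `stub_dr5_core` must use goodness. -/
example : ¬ LayerInequality (Set.range intVec) := Negative.not_layerInequality_cubic

/-- … and so does the linear census `LinearAxisCensusAt` (landed p172213). -/
example : ¬ LinearAxisCensusAt (Set.range intVec) := Negative.not_linearAxisCensusAt_cubic

/-! ## (d′) Targets, cycle 2 — hypothesis anatomy of the ONE open stub `stub_dr5_core` (skeleton v6;
`targets = []`, `stuck_stubs = []` in this seat's payload) — LANDED p172900 as
`Theorems/FiveFoldRation/Negative/CoreAnatomy.lean` (imported; restated here against the named `CoreSig`)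

Net result of the three theorems below: `stub_dr5_core` ⇔ `∀ δ > 0, ∀ S, IsAdmissible δ S → LayerInequality S`;
inside it `FrontEnd S` is implied by admissibility (landed glue) and, conversely, `hgood` is implied by the column
structure of the front end; with BOTH deleted it is false (`ℤ³`).  Together with (a″) (`hsep` load-bearing) and the
decoration status of `hdense` (§ (a″) docstring), the stub has no spare hypothesis and `FiveFoldRation_of` smuggles
no gap: the open stub is the crux's own mechanism for one `S` at a time (constants may depend on `S`, which by
(a″) they must — at least on its scale `δ`). -/

/-- Statement of the open stub `stub_dr5_core`, verbatim (= `Sketch.Sig.stub_dr5_core` textually). -/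
def CoreSig : Prop :=
  ∀ δ : ℝ, 0 < δ → ∀ S : Set (EuclideanSpace ℝ (Fin 3)), Summit.AtomisticToContinuum.Crystallization.Theorems.FiveFoldRation.IsAdmissible δ S → Summit.AtomisticToContinuum.Crystallization.Theorems.FiveFoldRation.FrontEnd S → Summit.AtomisticToContinuum.Crystallization.Theorems.FiveFoldRation.LayerInequality S

/-- The `FrontEnd S` hypothesis of the open stub is implied by admissibility (landed glue
`frontEnd_of_isAdmissible`, p171620): the stub IS the crux-strength statement `IsAdmissible δ S → LayerInequality S`.
[folklore] -/
theorem coreSig_iff_dropFrontEnd :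
    CoreSig ↔ ∀ δ : ℝ, 0 < δ → ∀ S : Set E3, IsAdmissible δ S → LayerInequality S :=
  Negative.core_iff_dropFrontEnd

/-- **Columns force goodness**: the column structure `HasColumns S` of the front end already makes every site
alphabet-good (a non-axis site is {fcc,hcp}-good by definition of `axisSites`; an axis site lies on a column and
(c3) hands it a decahedral matching).  So inside `stub_dr5_core` the conjunct `hgood` of `IsAdmissible δ S` is
implied by `FrontEnd S`. [folklore] -/
theorem isAlphabetGood_of_hasColumns {S : Set E3} (h : HasColumns S) : ∀ y ∈ S, IsAlphabetGood S y :=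
  Negative.isAlphabetGood_of_hasColumns h

/-- Hence the stub with `hgood` DELETED from admissibility is EQUIVALENT to the stub (no lever there). [folklore] -/
theorem coreSig_iff_dropGood :
    CoreSig ↔ ∀ δ : ℝ, 0 < δ → ∀ S : Set E3, (∀ y ∈ S, ∀ z ∈ S, y ≠ z → δ ≤ dist y z) →
      (∃ R₁ : ℝ, ∀ p : E3, ∃ y ∈ S, dist y p ≤ R₁) → FrontEnd S → LayerInequality S :=
  Negative.core_iff_dropGood

/-- **Goodness in SOME form is load-bearing for the core**: with both `hgood` and the front end deleted the stub is
false — witness `ℤ³` (`1`-separated, covering radius `2`; `¬ LayerInequality ℤ³` landed p172213). [folklore] -/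
theorem core_false_without_good :
    ¬ ∀ δ : ℝ, 0 < δ → ∀ S : Set E3, (∀ y ∈ S, ∀ z ∈ S, y ≠ z → δ ≤ dist y z) →
      (∃ R₁ : ℝ, ∀ p : E3, ∃ y ∈ S, dist y p ≤ R₁) → LayerInequality S :=
  Negative.core_false_without_good

/-! ## (a″) `hsep` IS load-bearing — near-miss (infinite witness): the scale-drifted rod `F_ε(Rod)`

This completes the load-bearing table of the crux: `hgood` (LANDED, `ℤ³`, § (a′)) · `hsep` (HERE, paper +
numerics) · `hdense` (DECORATION on paper — see the docstring of `fiveFoldRation_false_without_sep`). -/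

/-- `FiveFoldRation` with the SEPARATION hypothesis deleted (`δ` then idles and is dropped), written in the named
vocabulary of the Defs file (legitimate by `fiveFoldRation_iff_axisCount`, cf. `fiveFoldRation_iff_sep_guarded`).
Hypothesis-analysis predicate (Negative/ lane), not a literature fact. -/
def FiveFoldRationWithoutSep : Prop :=
  ∀ S : Set E3, (∃ R₁ : ℝ, ∀ p : E3, ∃ y ∈ S, dist y p ≤ R₁) → (∀ y ∈ S, IsAlphabetGood S y) →
    ∀ θ : ℝ, 0 < θ → ∃ L₀ : ℝ, ∀ L : ℝ, L₀ ≤ L → ∀ c : E3, axisCount S c L ≤ θ * L ^ 3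

/-- Sanity of the reading: the crux is exactly `FiveFoldRationWithoutSep` guarded by `δ`-separation. -/
theorem fiveFoldRation_iff_sep_guarded :
    Summit.AtomisticToContinuum.Crystallization.Theses.DisclinationRation.FiveFoldRation ↔
      ∀ δ : ℝ, 0 < δ → ∀ S : Set E3, (∀ y ∈ S, ∀ z ∈ S, y ≠ z → δ ≤ dist y z) →
        (∃ R₁ : ℝ, ∀ p : E3, ∃ y ∈ S, dist y p ≤ R₁) → (∀ y ∈ S, IsAlphabetGood S y) →
        ∀ θ : ℝ, 0 < θ → ∃ L₀ : ℝ, ∀ L : ℝ, L₀ ≤ L → ∀ c : E3, axisCount S c L ≤ θ * L ^ 3 := by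
  rw [fiveFoldRation_iff_axisCount]
  exact ⟨fun h δ hδ S a b c => h δ hδ S ⟨a, b, c⟩, fun h δ hδ S hS => h δ hδ S hS.1 hS.2.1 hS.2.2⟩

/-- The un-separated statement trivially implies the crux (so refuting it is the informative direction). -/
theorem fiveFoldRation_of_withoutSep (h : FiveFoldRationWithoutSep) :
    Summit.AtomisticToContinuum.Crystallization.Theses.DisclinationRation.FiveFoldRation :=
  fiveFoldRation_iff_sep_guarded.2 fun _ _ S _ hdense hgood => h S hdense hgood

/-- NEAR-MISS (true on paper, numerically certified at pattern level, NOT formalisable — infinite witness):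
**without `hsep` the crux is false.**  WITNESS: the scale-drifted decahedral rod `S_ε = F_ε(Rod)`,
`F_ε(x) = |x|^{-ε}·x` (origin = an axis site of the rod of § (b)), `ε = 1/100`.
* `S_ε` is relatively dense (`F_ε` is onto and `1`-Lipschitz up to `1 + 2ε` outside the unit ball; covering radius
  `≤ 2`), NOT uniformly separated (`d_y ≈ 0.99·|y|^{-ε} → 0`), and EVERYWHERE ALPHABET-GOOD at `1/20`:
  `drift/driftcheck.py` (pure python; pattern-level test of THIS crux: `|T_y|`, exact bottleneck assignment, O(3)
  refinement; runs in-session + kit j027796): near field `|y| ≤ 5`, all `776` sites: `|T_y| = 12` everywhere, worst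
  minimax deviation `0.0324` (hcp-type sites at `|y| ≈ 1`; per-`|y|` bins `0.0324, 0.0293, 0.0275, 0.0275,
  0.0269`, decreasing to the far-field value), shell radii `≤ 1.0297 d_y`, next site `≥ 1.3972 d_y`; far field
  on the axis (windows of `172` sites about `F_ε(0,0,Z₀)`, `Z₀ = 10³, 10⁶, 10¹²`, local scale `Z₀^{-ε} = 0.933,
  0.871, 0.759`): worst deviation `0.0222 / 0.0222 / 0.0223` (= the rod's `0.0201` plus the `1 %` axial
  compression `DF_ε = |x|^{-ε}(I − ε x̂⊗x̂)`); `ε = 0` reproduces cycle 1 (`0.0201`, axis `0.0078`).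
* its axis sites are `± n^{1−ε}·u` (`n ∈ ℕ`; numerically at `z = 0, ±1, ±1.986, ±2.967, ±3.945, ±4.920`),
  decahedral-good at deviation `≤ 0.0161` and NOT {fcc,hcp}-good (certificate: a shell point with FIVE shell-mates
  at rescaled distance `≤ 1.0013 < √2 − 1/10`, impossible around a `4`-valent (anti)cuboctahedron vertex; best
  fcc/hcp fit `≥ 0.589`);
* so for `c = Z₀·u` and `1 ≤ L ≤ Z₀/2`: `axisCount S_ε c L ≥ (Z₀+L)^{1/(1−ε)} − (Z₀−L)^{1/(1−ε)} − 1 ≥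
  2L·(Z₀/2)^{ε/(1−ε)} − 1` (convexity), which exceeds `θ L³` once `(Z₀/2)^{ε/(1−ε)} ≥ θ L²`, e.g. `θ = 1`,
  `L = max L₀ 1`, `Z₀ = 2·L^{198}` for `ε = 1/100`: the conclusion fails for every `L₀`.
* robustness: `ε = 1/50` still passes (near field worst `0.0461`, far `0.0312`), `ε = −1/100` (scale GROWING, the
  separated non-relatively-dense variant used below) passes with worst `0.0218`; all in `drift/results_local*.txt`
  (evidence on the crux item).
CONSEQUENCES FOR THE LINE: (1) every axis-census constant must carry the scale — `LinearAxisCensusAt`-type bounds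
can hold at best as `C·(L/δ + 1)` (IdeatorOne's form), never with an absolute constant, and `LayerInequality S_ε`
itself fails (`N(ρ) ≈ 2ρ·K` about far centres with `K → ∞` violates it at `r = 16 W₀`) although `S_ε` has the
whole front end (shell symmetry within `3 %`, pattern links, capped squares, one bi-infinite column): any proof of
`stub_dr5_core` must use `hsep` quantitatively (in the comparison-geometry engine it enters as the lower bound
`δ` on the edge length of the ideal complex, i.e. the number `≈ L/δ` of ideal edges across `B_L`).
(2) `hdense` looks like DECORATION given `hsep` + `hgood` (paper): the developing map of the ideal complex built
from an everywhere-good separated `S` is a covering of `ℝ³` by path lifting with steps `≥ δ/1.05`, so such an `S`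
is automatically relatively dense on the sheet it lives on, and the curvature count happens in ideal balls of
radius `≤ 1.05·L/δ + 1` regardless; the opposite drift `F_{−ε}(fcc)` (scale GROWING like `|x|^{ε}`) is
`1`-separated, everywhere fcc-good and not relatively dense, with the conclusion trivially true — no witness
against dropping `hdense` exists or is expected.
OBSTRUCTION to a Lean proof of this theorem: the witness is necessarily infinite and aperiodic with transcendental
coordinates; even the rod alone is out of reach (§ (b)). [folklore] -/
theorem fiveFoldRation_false_without_sep : ¬ FiveFoldRationWithoutSep := by
  sorry

/-! ## (b′) Closed and knotted columns (paper; information for the engine)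

`HasColumns` allows `γ : ℤ → E3` periodic, i.e. CLOSED five-fold loops, and says nothing about knotting or
linking.  In the ideal flat cone-manifold: an unknotted closed column bounding an embedded disc is impossible (the
holonomy along a longitude is a screw motion with translation part = the column's ideal length `> 0`, but the
longitude is null-homotopic in the complement's abelian quotient … contradiction), while knotted / linked
families are not excluded by holonomy alone — they ARE rationed by the curvature bound of § (e′) like straight
ones (total singular length `O(ideal radius)` per ideal ball), so they cost nothing extra in the census but must
not be forgotten in a cellulation argument that inducts over "columns crossing a ball".

## (e′) Why it resists, sharpened with page-level citations (presearch of this cycle; corpus held)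

* ENGINE, no collapsing assumption needed: Li–Naber, *Quantitative estimates on the singular sets of Alexandrov
  spaces*, Peking Math. J. 2020 (arXiv:1912.03615) — Cor. 1.4 (p. 4): for every `n`, `ε > 0` there is `C(n,ε)`
  with `𝓗^k(𝒮^k_ε(X) ∩ B_1(p)) < C(n,ε)` for ANY `X ∈ Alex^n(−1)`, `p ∈ X` ("independent of the volume", p. 2);
  Thm 1.5 (p. 4): `𝓗^n(B_r(𝒮^k_{ε,r}(X)) ∩ B_1(p)) ≤ C(n,ε)·r^{n−k}`.  Applied with `n = 3`, `k = 1` to the ideal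
  complex `K(S)` rescaled by the ideal radius `ρ ≈ L/d`: a column point at scale `r = 1/(4ρ)` sees exactly
  `ℝ × C(S¹_{5 arccos(1/3)})`, which is `c·ω₅·r`-far from every `ℝ²`-split ball (`ω₅ = 2π − 5 arccos(1/3) = 0.12834`),
  distinct columns are `≥ 1/√2` ideal units apart, so the `r`-tubes about the columns are disjoint and Thm 1.5
  gives total rescaled column length `≤ C'` in `B_1`, i.e. `≤ C'·ρ` ideal length and `≤ C''·(L/δ + 1)` axis sites
  in `B̄_L(c)` — a LINEAR census with the constant depending on `δ` only (consistent with (a″)(1)).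
* Smoothing alternative: Lebedeva–Matveev–Petrunin–Shevchishin, *Smoothing 3-dimensional polyhedral spaces*,
  ERA-MS 22 (2015) (arXiv:1411.0307), Thm 1 (p. 3): a COMPACT polyhedral 3-manifold with non-negative curvature is a
  limit of Riemannian 3-manifolds with `sec ≥ 0` — then Petrunin's `∫_{B_1} Sc ≤ C(n)` (St. Petersburg Math. J. 20
  (2009) 255–265; cited e.g. in arXiv:1304.0292 p. 34 — not held here) bounds `ω₅ ×` singular length; compactness
  makes this route clumsier than Li–Naber for our complete non-compact `K(S)`.
* NOT applicable as is: T. T. Nguyen (?) *Singular vertices of nonnegatively curved INTEGRAL polyhedral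
  3-manifolds* (arXiv:2111.02301): "integral" = holonomy preserves a lattice (monodromy in `S₄` or `D₆`), cone
  angles `∈ {π/3, π/2, 2π/3, π, 4π/3, 3π/2, 5π/3}` (Cor. 2.5, p. 5) and then singular VERTICES are boundedly many;
  our column angle `5 arccos(1/3) = 352.64°` is irrational to `π`, the unit-edge T/O complex with a five-fold
  column is not integral in that sense, and with the alphabet {fcc, hcp, deca} there are no singular vertices at
  all (no node letter: columns never branch or end).  Cited so that nobody imports the finiteness of singular
  lines conjectured there (their § 5) into this setting — here `≤ 48` PARALLEL columns (Cohn-Vossen) but no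
  absolute bound on skew families beyond the linear census.
* Engine-free lower-tech alternative for the provers (suggestion only): Bishop–Gromov in the CBB(0) space `K(S)`
  — every column crossing `B_ρ(x)` near its centre removes ideal volume `≥ c·ω₅·ρ³` from `|B_ρ(x)| ≤ (4π/3)ρ³·(1 −
  deficit)`, while the global bi-Lipschitz comparison with `ℝ³` (uses `hdense` + `hsep`: `|B_ρ| ≥ (4π/3)(ρ δ/2.2R₁)³`)
  bounds the total deficit; this yields "≤ C(δ,R₁) columns through the middle of any ball", which with the column
  structure is again a linear census.  Needs an averaging lemma over centres; not checked beyond the single-column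
  computation (deficit of one straight column through the centre: `2ω₅ρ³/3`). -/

end Summit.AtomisticToContinuum.Crystallization.Cruxes.FiveFoldRation.Disproof

end
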